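import Literature.NumberTheory.LFunctions.ConreyVRightEdge
import Literature.NumberTheory.LFunctions.RiemannSiegelChiStirling
import HarnessLib

/-!
# Conrey's Lemma 4: the approximate functional equation for `V = 𝜙(−L⁻¹δ)𝓡 + χ · (𝜙∘(1−X))(L⁻¹δ)K`

Topic `Literature/NumberTheory/LFunctions`. Everything in this file is PROVED (no definitions, no
named facts).

Levinson's method in Conrey's form (tree: `Literature.NumberTheory.LFunctions.conreyV`,
`Literature.NumberTheory.LFunctions.levinson_criticalLineProportion_ge`) needs the mollified mean
square of `V(a + it)`, `a = ½ − R/log T`, and the first step of every evaluation of it is the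
approximate functional equation for `V`: J. B. Conrey, *Zeros of derivatives of Riemann's ξ-function
on the critical line*, J. Number Theory 16 (1983), §4, Lemma 4 — "`V = C + χD + O(T^{−1/4})` with
the Dirichlet polynomials `C`, `D`"; in Levinson's original (Adv. Math. 13 (1974), (2.10)–(2.18)):
`G(a+it) = H(a+it) + H₁(t)`, `H = g₁ + χ₁ g₂/log(t/2π)` (his (2.17)), `H₁(t) = O(t^{−1/4})`, with
`g₁(s) = Σ_{n ≤ √(t/2π)} n^{−s}(1 − log n/L)`, `g₂(s) = Σ n^{s−1} log n` ((2.12)–(2.13)).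

For a real polynomial `𝜙`, `L = log T`, `T ≤ t ≤ 2T`, `|σ| ≤ A`, `x₀ = √(t/2π)`, `N = ⌊x₀⌋`:

* `ConreyAFE.norm_conreyV_sub_afe_le` —
  `‖V(σ+it) − (Σ_{n≤N} 𝜙(log n/L) n^{−σ−it} + χ(σ+it) Σ_{n≤N} 𝜙(1 − log n/L) n^{σ−1+it})‖`
  `  ≤ 17e·8^{A+1} (C_𝜙 x₀^{−σ} + C_q ‖χ(σ+it)‖ x₀^{σ−1})`, `C_p = Σ_k |p_k| k!`, `q = 𝜙∘(1−X)`
  (for `log T ≥ 2`, `T ≥ 128π + 1`, `√(T/2π) ≥ 4A + 8`);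
* `ConreyAFE.norm_conreyV_sub_afe_le_rpow` — with `‖χ(σ+it)‖ ≤ 2 (t/2π)^{½−σ}` (Stirling,
  `RiemannSiegelChiStirling.lean`) the error is `17e·8^{A+1} (C_𝜙 + 2C_q) x₀^{−σ}`; at
  `σ = a = ½ − R/L` this is Conrey's `O(T^{−1/4})` (`x₀^{−a} ≍ T^{−1/4} e^{R/2}`).

## Proof

`𝓡(s) = Σ_{n ≤ N(t)} n^{−s} + O(4^{|σ|} x₀^{−σ})` uniformly (Titchmarsh §4.16; tree
`Literature.NumberTheory.LFunctions.SiegelIntegral.norm_riemannAux_sub_sum_le`). Freeze the length at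
`N₀ = N(t₀)`: on the circle `|w − s₀| = r ≤ ½` the length `N(Im w)` differs from `N₀` by at most one
(`natFloor_sqrt_near`), and one boundary term costs `2^{|σ|} x₀^{−σ}`
(`norm_riemannAux_sub_sum_le_of_near`), so the *holomorphic* error
`E(w) = 𝓡(w) − Σ_{n ≤ N₀} n^{−w}` is `≤ 17 · 8^A x₀^r x₀^{−σ₀}` there
(`norm_riemannAuxErr_le_of_mem_sphere`). With `r = L⁻¹` (`x₀^{1/L} ≤ e`) the Cauchy transfer
`Literature.NumberTheory.LFunctions.norm_polyDerivOp_le` bounds `𝜙(−L⁻¹δ)E` by `C_𝜙 · 17e·8^A x₀^{−σ}`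
(the factors `L^k` of the `k`-th Cauchy estimate cancel against `L^{−k}`), while on the monomials
`𝜙(a δ) n^{−s} = 𝜙(−a log n) n^{−s}`, `𝜙(a δ) n^{s−1} = 𝜙(a log n) n^{s−1}`
(`polyDerivOp_natCast_cpow_neg`, `polyDerivOp_natCast_cpow_sub_one`). The factor `K(s) = conj 𝓡(1−s̄)`
is handled by the reflection rule `Literature.Analysis.Complex.conj_polyDerivOp_one_sub_conj` and
`conj (n^{−(1−s̄)}) = n^{s−1}`, with the circle around `1 − s̄₀ = (1−σ₀) + it₀`.

## References

* J. B. Conrey, *Zeros of derivatives of Riemann's ξ-function on the critical line*, J. Number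
  Theory 16 (1983), 49–74, §4, Lemma 4. [Conrey1983]
* N. Levinson, Adv. Math. 13 (1974), 383–436, §2 eqs. (2.10)–(2.18). [Levinson1974]
* E. C. Titchmarsh, *The Theory of the Riemann Zeta-Function*, 2nd ed. (1986), §4.16. [Titchmarsh1986]
-/

noncomputable section

open Complex Polynomial Set Filter Metric
open scoped Real ComplexConjugate

namespace Literature.NumberTheory.LFunctions

open Literature.Analysis.Complex SiegelIntegral

namespace ConreyAFE

/-! ### `p(a d/ds)` on the Dirichlet monomials `n^{-s}` and `n^{s-1}` -/

/-- `n^{-s} = exp(−(log n) s)` for `n ≥ 1`. [folklore] -/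
theorem natCast_cpow_neg_eq_cexp {n : ℕ} (hn : 1 ≤ n) (s : ℂ) :
    (n : ℂ) ^ (-s) = cexp (-(Real.log n : ℂ) * s) := by
  rw [Complex.cpow_def_of_ne_zero (by exact_mod_cast (show n ≠ 0 by omega)), ← Complex.ofReal_natCast,
    ← Complex.ofReal_log (Nat.cast_nonneg n)]
  congr 1
  push_cast
  ring

/-- `n^{s-1} = exp((log n) s) / n` for `n ≥ 1`. [folklore] -/
theorem natCast_cpow_sub_one_eq_cexp {n : ℕ} (hn : 1 ≤ n) (s : ℂ) :
    (n : ℂ) ^ (s - 1) = (n : ℂ)⁻¹ * cexp ((Real.log n : ℂ) * s) := by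
  have hn0 : (n : ℂ) ≠ 0 := by exact_mod_cast (show n ≠ 0 by omega)
  rw [Complex.cpow_sub _ _ hn0, Complex.cpow_one, Complex.cpow_def_of_ne_zero hn0,
    ← Complex.ofReal_natCast, ← Complex.ofReal_log (Nat.cast_nonneg n), div_eq_mul_inv, mul_comm]

/-- `(d/ds)ᵏ n^{-s} = (−log n)ᵏ n^{-s}`. [folklore] -/
theorem iteratedDeriv_natCast_cpow_neg {n : ℕ} (hn : 1 ≤ n) (k : ℕ) :
    iteratedDeriv k (fun s : ℂ => (n : ℂ) ^ (-s)) =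
      fun s => (-(Real.log n : ℂ)) ^ k * (n : ℂ) ^ (-s) := by
  have hfun : (fun s : ℂ => (n : ℂ) ^ (-s)) = fun s => cexp (-(Real.log n : ℂ) * s) :=
    funext fun s => natCast_cpow_neg_eq_cexp hn s
  rw [hfun, iteratedDeriv_cexp_const_mul]
  funext s
  rw [natCast_cpow_neg_eq_cexp hn]

/-- `(d/ds)ᵏ n^{s-1} = (log n)ᵏ n^{s-1}`. [folklore] -/
theorem iteratedDeriv_natCast_cpow_sub_one {n : ℕ} (hn : 1 ≤ n) (k : ℕ) :
    iteratedDeriv k (fun s : ℂ => (n : ℂ) ^ (s - 1)) =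
      fun s => ((Real.log n : ℂ)) ^ k * (n : ℂ) ^ (s - 1) := by
  have hfun : (fun s : ℂ => (n : ℂ) ^ (s - 1)) = fun s => (n : ℂ)⁻¹ * cexp ((Real.log n : ℂ) * s) :=
    funext fun s => natCast_cpow_sub_one_eq_cexp hn s
  rw [hfun]
  funext s
  have hcd : ContDiffAt ℂ k (fun s : ℂ => cexp ((Real.log n : ℂ) * s)) s :=
    (Complex.contDiff_exp.comp (contDiff_const.mul contDiff_id)).contDiffAt
  rw [iteratedDeriv_const_mul (f := fun s : ℂ => cexp ((Real.log n : ℂ) * s)) _ hcd,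
    iteratedDeriv_cexp_const_mul, natCast_cpow_sub_one_eq_cexp hn]
  ring

/-- **`p(a d/ds) n^{-s} = p(−a log n) n^{-s}`.** [cite: Conrey1983, §4] -/
theorem polyDerivOp_natCast_cpow_neg (p : ℝ[X]) (a : ℝ) {n : ℕ} (hn : 1 ≤ n) (s : ℂ) :
    polyDerivOp p a (fun s : ℂ => (n : ℂ) ^ (-s)) s =
      ((p.eval (-a * Real.log n) : ℝ) : ℂ) * (n : ℂ) ^ (-s) := by
  rw [polyDerivOp_def, Polynomial.eval_eq_sum, Polynomial.sum_def]
  simp only [Complex.ofReal_sum, Complex.ofReal_mul, Complex.ofReal_pow, Complex.ofReal_neg,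
    Finset.sum_mul]
  refine Finset.sum_congr rfl fun k _ => ?_
  rw [iteratedDeriv_natCast_cpow_neg hn k]
  ring

/-- **`p(a d/ds) n^{s-1} = p(a log n) n^{s-1}`.** [cite: Conrey1983, §4] -/
theorem polyDerivOp_natCast_cpow_sub_one (p : ℝ[X]) (a : ℝ) {n : ℕ} (hn : 1 ≤ n) (s : ℂ) :
    polyDerivOp p a (fun s : ℂ => (n : ℂ) ^ (s - 1)) s =
      ((p.eval (a * Real.log n) : ℝ) : ℂ) * (n : ℂ) ^ (s - 1) := by
  rw [polyDerivOp_def, Polynomial.eval_eq_sum, Polynomial.sum_def]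
  simp only [Complex.ofReal_sum, Complex.ofReal_mul, Complex.ofReal_pow, Finset.sum_mul]
  refine Finset.sum_congr rfl fun k _ => ?_
  rw [iteratedDeriv_natCast_cpow_sub_one hn k]
  ring

/-! ### Linearity of `p(a d/ds)` in the function -/

/-- `p(a d/ds)(F − G) = p(a d/ds)F − p(a d/ds)G` for entire `F`, `G`. [folklore] -/
theorem polyDerivOp_sub (p : ℝ[X]) (a : ℝ) {F G : ℂ → ℂ} (hF : Differentiable ℂ F)
    (hG : Differentiable ℂ G) (s : ℂ) :
    polyDerivOp p a (fun s => F s - G s) s = polyDerivOp p a F s - polyDerivOp p a G s := by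
  rw [polyDerivOp_def, polyDerivOp_def, polyDerivOp_def, ← Finset.sum_sub_distrib]
  refine Finset.sum_congr rfl fun k _ => ?_
  rw [show (fun s => F s - G s) = F - G from rfl,
    iteratedDeriv_sub (hF.contDiff.contDiffAt) (hG.contDiff.contDiffAt)]
  ring

/-- `p(a d/ds)(Σᵢ cᵢ fᵢ) = Σᵢ cᵢ p(a d/ds) fᵢ` for entire `fᵢ`. [folklore] -/
theorem polyDerivOp_finset_sum (p : ℝ[X]) (a : ℝ) {ι : Type*} (I : Finset ι) (c : ι → ℂ)
    (f : ι → ℂ → ℂ) (hf : ∀ i ∈ I, Differentiable ℂ (f i)) (s : ℂ) :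
    polyDerivOp p a (fun s => ∑ i ∈ I, c i * f i s) s = ∑ i ∈ I, c i * polyDerivOp p a (f i) s := by
  rw [polyDerivOp_def]
  have hk : ∀ k : ℕ, iteratedDeriv k (fun s => ∑ i ∈ I, c i * f i s) s =
      ∑ i ∈ I, c i * iteratedDeriv k (f i) s := by
    intro k
    have e : (fun s => ∑ i ∈ I, c i * f i s) = ∑ i ∈ I, (fun s => c i * f i s) := by
      funext s; simp [Finset.sum_apply]
    rw [e, iteratedDeriv_sum (f := fun i => fun s => c i * f i s)
      (fun i hi => ((differentiable_const (c i)).mul (hf i hi)).contDiff.contDiffAt)]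
    refine Finset.sum_congr rfl fun i hi => ?_
    exact iteratedDeriv_const_mul _ ((hf i hi).contDiff.contDiffAt)
  simp_rw [hk, Finset.mul_sum]
  rw [Finset.sum_comm]
  refine Finset.sum_congr rfl fun i _ => ?_
  rw [polyDerivOp_def, Finset.mul_sum]
  refine Finset.sum_congr rfl fun k _ => ?_
  ring

/-! ### The length `N(t) = ⌊√(t/2π)⌋` is stable on small discs -/

/-- `|x₀(t) − x₀(t₀)| (x₀(t) + x₀(t₀)) = |t − t₀|/(2π)` (`x₀(u) = √(u/2π)`), so for `|t − t₀| ≤ 1`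
and `x₀(t₀) ≥ 1` the two roots differ by less than `1`. [folklore] -/
theorem abs_sqrt_sub_sqrt_lt_one {t t₀ : ℝ} (ht₀ : 0 < t₀) (hx₀ : 1 ≤ Real.sqrt (t₀ / (2 * π)))
    (ht : |t - t₀| ≤ 1) (ht' : 0 ≤ t) :
    |Real.sqrt (t / (2 * π)) - Real.sqrt (t₀ / (2 * π))| < 1 := by
  have hπ := Real.pi_pos
  have hπ3 := Real.pi_gt_three
  set x := Real.sqrt (t / (2 * π)) with hx
  set x₀ := Real.sqrt (t₀ / (2 * π)) with hx₀def
  have hx0 : 0 ≤ x := Real.sqrt_nonneg _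
  have hsq : x ^ 2 = t / (2 * π) := Real.sq_sqrt (by positivity)
  have hsq₀ : x₀ ^ 2 = t₀ / (2 * π) := Real.sq_sqrt (by positivity)
  have hdiff : (x - x₀) * (x + x₀) = (t - t₀) / (2 * π) := by
    have : (x - x₀) * (x + x₀) = x ^ 2 - x₀ ^ 2 := by ring
    rw [this, hsq, hsq₀]; ring
  have hsum : 1 ≤ x + x₀ := by linarith
  have habs : |x - x₀| * (x + x₀) = |t - t₀| / (2 * π) := by
    rw [← abs_of_pos (by linarith : 0 < x + x₀), ← abs_mul, hdiff, abs_div,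
      abs_of_pos (by positivity : (0:ℝ) < 2 * π)]
  have h1 : |t - t₀| / (2 * π) < 1 := by
    rw [div_lt_one (by positivity)]; linarith
  by_contra hge
  have hge' : 1 ≤ |x - x₀| := le_of_not_gt hge
  have : 1 * 1 ≤ |x - x₀| * (x + x₀) := mul_le_mul hge' hsum zero_le_one (abs_nonneg _)
  linarith

/-- For `|t − t₀| ≤ 1` (and `√(t₀/2π) ≥ 1`): `N(t) ≤ N(t₀) + 1` and `N(t₀) ≤ N(t) + 1`. [folklore] -/
theorem natFloor_sqrt_near {t t₀ : ℝ} (ht₀ : 0 < t₀) (hx₀ : 1 ≤ Real.sqrt (t₀ / (2 * π)))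
    (ht : |t - t₀| ≤ 1) (ht' : 0 ≤ t) :
    ⌊Real.sqrt (t / (2 * π))⌋₊ ≤ ⌊Real.sqrt (t₀ / (2 * π))⌋₊ + 1 ∧
      ⌊Real.sqrt (t₀ / (2 * π))⌋₊ ≤ ⌊Real.sqrt (t / (2 * π))⌋₊ + 1 := by
  have h := abs_sqrt_sub_sqrt_lt_one ht₀ hx₀ ht ht'
  have h1 := (abs_lt.1 h).1
  have h2 := (abs_lt.1 h).2
  constructor
  · rw [← Nat.floor_add_one (Real.sqrt_nonneg _)]
    exact Nat.floor_le_floor (by linarith)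
  · rw [← Nat.floor_add_one (Real.sqrt_nonneg _)]
    exact Nat.floor_le_floor (by linarith)

/-! ### The Riemann–Siegel error with the length frozen -/

/-- **`𝓡(σ+it) − Σ_{n ≤ N'} n^{-σ-it} = O(4^{|σ|} x₀^{-σ})` for `N' ∈ {N−1, N, N+1}`**, `N = ⌊x₀⌋`,
`x₀ = √(t/2π)` (the tree's `norm_riemannAux_sub_sum_le`, plus one boundary term `n^{-σ}` with
`x₀/2 ≤ n ≤ 2x₀`). [cite: Titchmarsh1986, §4.16] -/
theorem norm_riemannAux_sub_sum_le_of_near {σ t : ℝ} {N' : ℕ} (ht : 128 * π ≤ t)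
    (hσ : |σ| ≤ Real.sqrt (t / (2 * π)) / 4)
    (hN' : N' ≤ ⌊Real.sqrt (t / (2 * π))⌋₊ + 1 ∧ ⌊Real.sqrt (t / (2 * π))⌋₊ ≤ N' + 1) :
    ‖riemannAux (σ + t * I) - ∑ n ∈ Finset.Icc 1 N', (n : ℂ) ^ (-((σ : ℂ) + t * I))‖ ≤
      6 * (4 : ℝ) ^ |σ| * Real.sqrt (t / (2 * π)) ^ (-σ) := by
  have hπ := Real.pi_pos
  have hπ3 := Real.pi_gt_three
  have ht0 : 0 < t := by nlinarith
  set x₀ := Real.sqrt (t / (2 * π)) with hx₀def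
  set N := ⌊x₀⌋₊ with hNdef
  have hx₀8 : 8 ≤ x₀ := by
    rw [hx₀def, Real.le_sqrt (by norm_num) (by positivity), le_div_iff₀ (by positivity)]
    nlinarith
  have hx₀pos : 0 < x₀ := by linarith
  have hmain := norm_riemannAux_sub_sum_le ht hσ
  rw [← hx₀def, ← hNdef] at hmain
  have hNle : (N : ℝ) ≤ x₀ := Nat.floor_le hx₀pos.le
  have hNgt : x₀ < N + 1 := Nat.lt_floor_add_one x₀
  have h4 : (1 : ℝ) ≤ (4 : ℝ) ^ |σ| := Real.one_le_rpow (by norm_num) (abs_nonneg _)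
  have h24 : (2 : ℝ) ^ |σ| ≤ (4 : ℝ) ^ |σ| :=
    Real.rpow_le_rpow (by norm_num) (by norm_num) (abs_nonneg _)
  have hxpow : 0 < x₀ ^ (-σ) := Real.rpow_pos_of_pos hx₀pos _
  -- one boundary term
  have hterm : ∀ n : ℕ, x₀ / 2 ≤ n → (n : ℝ) ≤ 2 * x₀ → 1 ≤ n →
      ‖((n : ℂ)) ^ (-((σ : ℂ) + t * I))‖ ≤ (4 : ℝ) ^ |σ| * x₀ ^ (-σ) := by
    intro n h1 h2 hn
    rw [Complex.norm_natCast_cpow_of_pos (by omega)]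
    have hre : (-((σ : ℂ) + t * I)).re = -σ := by simp
    rw [hre]
    calc (n : ℝ) ^ (-σ) ≤ (2 : ℝ) ^ |σ| * x₀ ^ (-σ) := rpow_neg_le_two_rpow_mul hx₀pos h1 h2
      _ ≤ (4 : ℝ) ^ |σ| * x₀ ^ (-σ) := mul_le_mul_of_nonneg_right h24 hxpow.le
  -- the three cases
  rcases Nat.lt_trichotomy N' N with hlt | heq | hgt
  · -- `N' + 1 = N`
    have hN'1 : N = N' + 1 := by omega
    rw [hN'1, Finset.sum_Icc_succ_top (by omega)] at hmain
    have hcast : (((N' + 1 : ℕ)) : ℝ) = (N : ℝ) := by rw [hN'1]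
    have hnorm := hterm (N' + 1) (by rw [hcast]; linarith) (by rw [hcast]; linarith) (by omega)
    calc _ = ‖(riemannAux (σ + t * I) - (∑ k ∈ Finset.Icc 1 N', (k : ℂ) ^ (-((σ : ℂ) + t * I)) +
          ((N' + 1 : ℕ) : ℂ) ^ (-((σ : ℂ) + t * I)))) + ((N' + 1 : ℕ) : ℂ) ^ (-((σ : ℂ) + t * I))‖ := by
          congr 1; ring
      _ ≤ 5 * (4 : ℝ) ^ |σ| * x₀ ^ (-σ) + (4 : ℝ) ^ |σ| * x₀ ^ (-σ) :=
          (norm_add_le _ _).trans (add_le_add hmain hnorm)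
      _ = 6 * (4 : ℝ) ^ |σ| * x₀ ^ (-σ) := by ring
  · rw [heq]
    calc _ ≤ 5 * (4 : ℝ) ^ |σ| * x₀ ^ (-σ) := hmain
      _ ≤ 6 * (4 : ℝ) ^ |σ| * x₀ ^ (-σ) := by nlinarith [mul_pos (lt_of_lt_of_le one_pos h4) hxpow]
  · -- `N' = N + 1`
    have hN'1 : N' = N + 1 := by omega
    rw [hN'1, Finset.sum_Icc_succ_top (by omega)]
    have hnorm := hterm (N + 1) (by push_cast; linarith) (by push_cast; linarith) (by omega)
    calc _ = ‖(riemannAux (σ + t * I) - ∑ k ∈ Finset.Icc 1 N, (k : ℂ) ^ (-((σ : ℂ) + t * I))) -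
          ((N + 1 : ℕ) : ℂ) ^ (-((σ : ℂ) + t * I))‖ := by congr 1; ring
      _ ≤ 5 * (4 : ℝ) ^ |σ| * x₀ ^ (-σ) + (4 : ℝ) ^ |σ| * x₀ ^ (-σ) :=
          (norm_sub_le _ _).trans (add_le_add hmain hnorm)
      _ = 6 * (4 : ℝ) ^ |σ| * x₀ ^ (-σ) := by ring

/-! ### The error on small circles around `σ₀ + it₀` -/

/-- **The frozen-length error on a circle.** For `1 ≤ A`, `|σ₀| ≤ A`, `0 < r ≤ ½`,
`t₀ ≥ 128π + 1`, `x₀ = √(t₀/2π) ≥ 4A + 4` and `|w − (σ₀ + it₀)| = r`: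
`‖𝓡(w) − Σ_{n ≤ ⌊x₀⌋} n^{−w}‖ ≤ 17 · 8^A · x₀^r · x₀^{−σ₀}`. [cite: Titchmarsh1986, §4.16] -/
theorem norm_riemannAuxErr_le_of_mem_sphere {A σ₀ t₀ r : ℝ} (hA : 1 ≤ A) (hσ₀ : |σ₀| ≤ A)
    (hr0 : 0 < r) (hr : r ≤ 1 / 2) (ht₀ : 128 * π + 1 ≤ t₀)
    (hx₀ : 4 * A + 4 ≤ Real.sqrt (t₀ / (2 * π))) {w : ℂ}
    (hw : w ∈ sphere ((σ₀ : ℂ) + t₀ * I) r) :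
    ‖riemannAux w - ∑ n ∈ Finset.Icc 1 ⌊Real.sqrt (t₀ / (2 * π))⌋₊, (n : ℂ) ^ (-w)‖ ≤
      17 * (8 : ℝ) ^ A * Real.sqrt (t₀ / (2 * π)) ^ r * Real.sqrt (t₀ / (2 * π)) ^ (-σ₀) := by
  have hπ := Real.pi_pos
  have hπ3 := Real.pi_gt_three
  have ht₀0 : 0 < t₀ := by nlinarith
  set x₀ := Real.sqrt (t₀ / (2 * π)) with hx₀def
  have hx₀1 : 1 ≤ x₀ := by linarith
  have hx₀pos : 0 < x₀ := by linarith
  -- coordinates of `w`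
  set σ := w.re with hσdef
  set t := w.im with htdef
  have hw' : w = (σ : ℂ) + t * I := (Complex.re_add_im w).symm
  have hnorm : ‖w - ((σ₀ : ℂ) + t₀ * I)‖ = r := by simpa using hw
  have hσr : |σ - σ₀| ≤ r := by
    have := Complex.abs_re_le_norm (w - ((σ₀ : ℂ) + t₀ * I))
    rw [hnorm] at this
    simpa [hσdef] using this
  have htr : |t - t₀| ≤ r := by
    have := Complex.abs_im_le_norm (w - ((σ₀ : ℂ) + t₀ * I))
    rw [hnorm] at this
    simpa [htdef] using this
  have hσr1 := (abs_le.1 hσr).1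
  have hσr2 := (abs_le.1 hσr).2
  have htr1 := (abs_le.1 htr).1
  have htr2 := (abs_le.1 htr).2
  have ht128 : 128 * π ≤ t := by linarith
  have ht0 : 0 ≤ t := by linarith
  have hσA : |σ| ≤ A + 1 / 2 := by
    rw [abs_le] at hσ₀ ⊢; constructor <;> linarith [hσ₀.1, hσ₀.2]
  -- the moving root `x = √(t/2π)`
  set x := Real.sqrt (t / (2 * π)) with hxdef
  have hxx₀ : |x - x₀| < 1 := abs_sqrt_sub_sqrt_lt_one ht₀0 hx₀1 (htr.trans (by linarith)) ht0
  have hxx₀1 := (abs_lt.1 hxx₀).1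
  have hxx₀2 := (abs_lt.1 hxx₀).2
  have hxpos : 0 < x := by linarith
  have hσx : |σ| ≤ x / 4 := hσA.trans (by linarith)
  have hN := natFloor_sqrt_near ht₀0 hx₀1 (htr.trans (by linarith)) ht0
  rw [hw']
  have hmain := norm_riemannAux_sub_sum_le_of_near (N' := ⌊x₀⌋₊) ht128 hσx ⟨hN.2, hN.1⟩
  refine hmain.trans ?_
  -- `4^{|σ|} ≤ 2·4^A`, `x^{-σ} ≤ 2^{|σ|} x₀^{-σ} ≤ √2 2^A x₀^r x₀^{-σ₀}`
  have h4 : (4 : ℝ) ^ |σ| ≤ 2 * (4 : ℝ) ^ A := by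
    calc (4 : ℝ) ^ |σ| ≤ (4 : ℝ) ^ (A + 1 / 2) :=
          Real.rpow_le_rpow_of_exponent_le (by norm_num) hσA
      _ = (4 : ℝ) ^ A * (4 : ℝ) ^ (1 / 2 : ℝ) := Real.rpow_add (by norm_num) _ _
      _ = 2 * (4 : ℝ) ^ A := by
          rw [show (4 : ℝ) = 2 ^ (2 : ℝ) by norm_num, ← Real.rpow_mul (by norm_num) 2 (1 / 2)]
          norm_num; ring
  have h2 : (2 : ℝ) ^ |σ| ≤ Real.sqrt 2 * (2 : ℝ) ^ A := by
    calc (2 : ℝ) ^ |σ| ≤ (2 : ℝ) ^ (A + 1 / 2) :=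
          Real.rpow_le_rpow_of_exponent_le (by norm_num) hσA
      _ = (2 : ℝ) ^ A * (2 : ℝ) ^ (1 / 2 : ℝ) := Real.rpow_add (by norm_num) _ _
      _ = Real.sqrt 2 * (2 : ℝ) ^ A := by rw [Real.sqrt_eq_rpow]; ring
  have hxσ : x ^ (-σ) ≤ (2 : ℝ) ^ |σ| * x₀ ^ (-σ) :=
    rpow_neg_le_two_rpow_mul hx₀pos (by linarith) (by linarith)
  have hx₀σ : x₀ ^ (-σ) ≤ x₀ ^ r * x₀ ^ (-σ₀) := by
    rw [show -σ = (σ₀ - σ) + -σ₀ by ring, Real.rpow_add hx₀pos]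
    exact mul_le_mul_of_nonneg_right (Real.rpow_le_rpow_of_exponent_le hx₀1 (by linarith))
      (Real.rpow_nonneg hx₀pos.le _)
  have h8 : (4 : ℝ) ^ A * (2 : ℝ) ^ A = (8 : ℝ) ^ A := by
    rw [← Real.mul_rpow (by norm_num) (by norm_num)]; norm_num
  have hsqrt2 : Real.sqrt 2 ≤ 17 / 12 := by
    rw [Real.sqrt_le_left (by norm_num)]; norm_num
  have hpos1 : 0 ≤ (4 : ℝ) ^ A := Real.rpow_nonneg (by norm_num) _
  have hpos2 : 0 ≤ (2 : ℝ) ^ A := Real.rpow_nonneg (by norm_num) _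
  have hpos3 : 0 ≤ x₀ ^ r * x₀ ^ (-σ₀) := by positivity
  calc 6 * (4 : ℝ) ^ |σ| * x ^ (-σ)
      ≤ 6 * (2 * (4 : ℝ) ^ A) * ((2 : ℝ) ^ |σ| * x₀ ^ (-σ)) := by
        gcongr
  _ ≤ 6 * (2 * (4 : ℝ) ^ A) * ((Real.sqrt 2 * (2 : ℝ) ^ A) * (x₀ ^ r * x₀ ^ (-σ₀))) := by
        gcongr
  _ = (12 * Real.sqrt 2) * ((4 : ℝ) ^ A * (2 : ℝ) ^ A) * (x₀ ^ r * x₀ ^ (-σ₀)) := by ring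
  _ ≤ 17 * (8 : ℝ) ^ A * (x₀ ^ r * x₀ ^ (-σ₀)) := by
        rw [h8]
        have : 0 ≤ (8 : ℝ) ^ A * (x₀ ^ r * x₀ ^ (-σ₀)) := by positivity
        nlinarith
  _ = 17 * (8 : ℝ) ^ A * x₀ ^ r * x₀ ^ (-σ₀) := by ring

/-! ### Conjugates of Dirichlet monomials -/

/-- `conj (n^{−(1 − s̄)}) = n^{s − 1}` for `n ≥ 1`. [folklore] -/
theorem conj_natCast_cpow_neg_one_sub_conj (n : ℕ) (s : ℂ) :
    conj ((n : ℂ) ^ (-(1 - conj s))) = (n : ℂ) ^ (s - 1) := by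
  have harg : ((n : ℂ)).arg ≠ π := by
    rw [Complex.natCast_arg]; exact Real.pi_ne_zero.symm
  have h := Complex.cpow_conj (n : ℂ) (-(1 - conj s)) harg
  rw [Complex.conj_natCast] at h
  rw [← h]
  congr 1
  simp [map_sub]

/-! ### The Cauchy transfer with `a = ∓L⁻¹`, `r = L⁻¹` -/

/-- With `|a| = r = L⁻¹` the coefficient of the Cauchy transfer is `Σ_k |p_k| k!`. [folklore] -/
theorem sum_coeff_transfer_eq (p : ℝ[X]) {L a : ℝ} (hL : 0 < L) (ha : |a| = L⁻¹) :
    ∑ k ∈ p.support, |p.coeff k| * |a| ^ k * (k.factorial : ℝ) / (L⁻¹) ^ k =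
      ∑ k ∈ p.support, |p.coeff k| * (k.factorial : ℝ) := by
  refine Finset.sum_congr rfl fun k _ => ?_
  rw [ha]
  have hpow : (L⁻¹) ^ k ≠ 0 := pow_ne_zero _ (inv_ne_zero hL.ne')
  field_simp

/-! ### Conrey's Lemma 4 -/

/-- **Conrey's Lemma 4 (the approximate functional equation for `V`).** Let `𝜙 ∈ ℝ[X]`, `A ≥ 1`,
`T ≥ T₀` with `log T ≥ 2`, `T ≥ 128π + 1` and `√(T/2π) ≥ 4A + 8`, and let `T ≤ t ≤ 2T`, `|σ| ≤ A`,
`L = log T`, `x₀ = √(t/2π)`, `N = ⌊x₀⌋`. Then, with `C_p = Σ_k |p_k| k!` and `q = 𝜙 ∘ (1 − X)`,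
`‖V(σ+it) − (Σ_{n ≤ N} 𝜙(log n/L) n^{−σ−it} + χ(σ+it) Σ_{n ≤ N} 𝜙(1 − log n/L) n^{σ−1+it})‖`
`  ≤ 17e·8^{A+1} (C_𝜙 x₀^{−σ} + C_q ‖χ(σ+it)‖ x₀^{σ−1})`
for `V = conreyV 𝜙 L = 𝜙(−L⁻¹δ)𝓡 + χ (𝜙∘(1−X))(L⁻¹δ)K` (Conrey, J. Number Theory 16 (1983), §4,
Lemma 4: "`V = C + χD + O(T^{−1/4})`"; Levinson 1974, (2.16)–(2.18)). The two errors come from the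
Cauchy transfer of the frozen-length Riemann–Siegel error on circles of radius `L⁻¹`
(`norm_riemannAuxErr_le_of_mem_sphere`, `Literature.NumberTheory.LFunctions.norm_polyDerivOp_le`),
on which `x₀^{L⁻¹} ≤ e`. [cite: Conrey1983, §4 Lemma 4] -/
theorem norm_conreyV_sub_afe_le (φ : ℝ[X]) {A T t σ : ℝ} (hA : 1 ≤ A) (hσ : |σ| ≤ A)
    (hT2 : Real.exp 2 ≤ T) (hT128 : 128 * π + 1 ≤ T) (hTx : 4 * A + 8 ≤ Real.sqrt (T / (2 * π)))
    (hTt : T ≤ t) (ht2T : t ≤ 2 * T) :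
    ‖conreyV φ (Real.log T) (σ + t * I) -
        (∑ n ∈ Finset.Icc 1 ⌊Real.sqrt (t / (2 * π))⌋₊,
            ((φ.eval (Real.log n / Real.log T) : ℝ) : ℂ) * (n : ℂ) ^ (-((σ : ℂ) + t * I)) +
          rsChi (σ + t * I) * ∑ n ∈ Finset.Icc 1 ⌊Real.sqrt (t / (2 * π))⌋₊,
            ((φ.eval (1 - Real.log n / Real.log T) : ℝ) : ℂ) * (n : ℂ) ^ (((σ : ℂ) + t * I) - 1))‖ ≤
      17 * Real.exp 1 * (8 : ℝ) ^ (A + 1) *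
        ((∑ k ∈ φ.support, |φ.coeff k| * (k.factorial : ℝ)) * Real.sqrt (t / (2 * π)) ^ (-σ) +
          (∑ k ∈ (φ.comp (1 - X)).support, |(φ.comp (1 - X)).coeff k| * (k.factorial : ℝ)) *
            ‖rsChi (σ + t * I)‖ * Real.sqrt (t / (2 * π)) ^ (σ - 1)) := by
  have hπ := Real.pi_pos
  have hπ3 := Real.pi_gt_three
  have hT0 : 0 < T := by nlinarith
  have ht0 : 0 < t := by linarith
  -- `L = log T ≥ 2`, `r = L⁻¹ ≤ ½`
  set L := Real.log T with hLdef
  have hL2 : 2 ≤ L := by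
    rw [hLdef, ← Real.log_exp 2]; exact Real.log_le_log (Real.exp_pos 2) hT2
  have hL0 : 0 < L := by linarith
  have hr0 : 0 < L⁻¹ := inv_pos.2 hL0
  have hrhalf : L⁻¹ ≤ 1 / 2 := by rw [inv_le_comm₀ hL0 (by norm_num)]; linarith
  -- `x₀`, `N`
  set x₀ := Real.sqrt (t / (2 * π)) with hx₀def
  set N := ⌊x₀⌋₊ with hNdef
  have hx₀T : Real.sqrt (T / (2 * π)) ≤ x₀ := Real.sqrt_le_sqrt (by gcongr)
  have hx₀A : 4 * A + 8 ≤ x₀ := hTx.trans hx₀T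
  have hx₀1 : 1 ≤ x₀ := by linarith
  have hx₀pos : 0 < x₀ := by linarith
  have ht128 : 128 * π + 1 ≤ t := hT128.trans hTt
  -- `x₀^{1/L} ≤ e`
  have hx₀r : x₀ ^ (L⁻¹) ≤ Real.exp 1 := by
    have hx₀le : x₀ ≤ T := by
      rw [hx₀def, Real.sqrt_le_left hT0.le, div_le_iff₀ (by positivity)]
      have : 1 ≤ T := by
        have := Real.add_one_le_exp (2 : ℝ); linarith
      nlinarith
    have hlog : Real.log x₀ ≤ L := Real.log_le_log hx₀pos hx₀le
    rw [Real.rpow_def_of_pos hx₀pos, Real.exp_le_exp]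
    calc Real.log x₀ * L⁻¹ ≤ L * L⁻¹ := mul_le_mul_of_nonneg_right hlog hr0.le
      _ = 1 := mul_inv_cancel₀ hL0.ne'
  -- the frozen sum `S` and the error `E`
  set s₀ : ℂ := (σ : ℂ) + t * I with hs₀
  set S : ℂ → ℂ := fun s => ∑ n ∈ Finset.Icc 1 N, (1 : ℂ) * (n : ℂ) ^ (-s) with hS
  set E : ℂ → ℂ := fun s => riemannAux s - S s with hE
  have hmono : ∀ n ∈ Finset.Icc 1 N, Differentiable ℂ (fun s : ℂ => (n : ℂ) ^ (-s)) := by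
    intro n hn
    have hn1 : 1 ≤ n := (Finset.mem_Icc.1 hn).1
    rw [show (fun s : ℂ => (n : ℂ) ^ (-s)) = fun s => cexp (-(Real.log n : ℂ) * s) from
      funext fun s => natCast_cpow_neg_eq_cexp hn1 s]
    fun_prop
  have hSd : Differentiable ℂ S := by
    simp only [hS]
    exact Differentiable.fun_sum fun n hn => (differentiable_const _).mul (hmono n hn)
  have hEd : Differentiable ℂ E := differentiable_riemannAux.sub hSd
  have hEeq : ∀ w, E w = riemannAux w - ∑ n ∈ Finset.Icc 1 N, (n : ℂ) ^ (-w) := by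
    intro w; simp only [hE, hS, one_mul]
  -- (1) the `𝓡`-part
  have hM₁ : ∀ w ∈ sphere s₀ L⁻¹, ‖E w‖ ≤ 17 * (8 : ℝ) ^ A * x₀ ^ (L⁻¹) * x₀ ^ (-σ) := by
    intro w hw
    rw [hEeq]
    exact norm_riemannAuxErr_le_of_mem_sphere hA hσ hr0 hrhalf ht128 (by linarith) hw
  have h1 : ‖polyDerivOp φ (-L⁻¹) E s₀‖ ≤
      (∑ k ∈ φ.support, |φ.coeff k| * (k.factorial : ℝ)) * (17 * (8 : ℝ) ^ A * x₀ ^ (L⁻¹) * x₀ ^ (-σ)) := by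
    have h := norm_polyDerivOp_le φ (-L⁻¹) hEd hr0 hM₁
    rwa [sum_coeff_transfer_eq φ hL0 (by rw [abs_neg, abs_of_pos hr0])] at h
  have hR : polyDerivOp φ (-L⁻¹) riemannAux s₀ =
      (∑ n ∈ Finset.Icc 1 N, ((φ.eval (Real.log n / L) : ℝ) : ℂ) * (n : ℂ) ^ (-s₀)) +
        polyDerivOp φ (-L⁻¹) E s₀ := by
    have hsub := polyDerivOp_sub φ (-L⁻¹) differentiable_riemannAux hSd s₀
    simp only [hE] at hsub ⊢
    rw [hsub]
    have hSop : polyDerivOp φ (-L⁻¹) S s₀ =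
        ∑ n ∈ Finset.Icc 1 N, ((φ.eval (Real.log n / L) : ℝ) : ℂ) * (n : ℂ) ^ (-s₀) := by
      simp only [hS]
      rw [polyDerivOp_finset_sum φ (-L⁻¹) (Finset.Icc 1 N) (fun _ => (1 : ℂ))
        (fun n => fun s : ℂ => (n : ℂ) ^ (-s)) hmono s₀]
      refine Finset.sum_congr rfl fun n hn => ?_
      rw [polyDerivOp_natCast_cpow_neg φ (-L⁻¹) (Finset.mem_Icc.1 hn).1 s₀, one_mul]
      congr 3
      field_simp
    rw [hSop]
    ring
  -- (2) the `K`-part: `K = S♭ + E♯`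
  set E' : ℂ → ℂ := fun s => conj (E (1 - conj s)) with hE'
  set S' : ℂ → ℂ := fun s => ∑ n ∈ Finset.Icc 1 N, (1 : ℂ) * (n : ℂ) ^ (s - 1) with hS'
  have hmono' : ∀ n ∈ Finset.Icc 1 N, Differentiable ℂ (fun s : ℂ => (n : ℂ) ^ (s - 1)) := by
    intro n hn
    have hn1 : 1 ≤ n := (Finset.mem_Icc.1 hn).1
    rw [show (fun s : ℂ => (n : ℂ) ^ (s - 1)) = fun s => (n : ℂ)⁻¹ * cexp ((Real.log n : ℂ) * s) from
      funext fun s => natCast_cpow_sub_one_eq_cexp hn1 s]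
    fun_prop
  have hS'd : Differentiable ℂ S' := by
    simp only [hS']
    exact Differentiable.fun_sum fun n hn => (differentiable_const _).mul (hmono' n hn)
  have hKd : Differentiable ℂ riemannAuxConj := differentiable_conj_one_sub_conj differentiable_riemannAux
  have hKsplit : (fun s => conj (E (1 - conj s))) = fun s => riemannAuxConj s - S' s := by
    funext s
    simp only [hE, hS, hS', riemannAuxConj, map_sub, map_sum, one_mul]
    congr 1
    refine Finset.sum_congr rfl fun n hn => ?_
    exact conj_natCast_cpow_neg_one_sub_conj n s
  have hE'op : polyDerivOp (φ.comp (1 - X)) L⁻¹ E' s₀ =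
      polyDerivOp (φ.comp (1 - X)) L⁻¹ riemannAuxConj s₀ - polyDerivOp (φ.comp (1 - X)) L⁻¹ S' s₀ := by
    simp only [hE']
    rw [hKsplit]
    exact polyDerivOp_sub _ _ hKd hS'd s₀
  have hS'op : polyDerivOp (φ.comp (1 - X)) L⁻¹ S' s₀ =
      ∑ n ∈ Finset.Icc 1 N, ((φ.eval (1 - Real.log n / L) : ℝ) : ℂ) * (n : ℂ) ^ (s₀ - 1) := by
    simp only [hS']
    rw [polyDerivOp_finset_sum _ _ (Finset.Icc 1 N) (fun _ => (1 : ℂ))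
      (fun n => fun s : ℂ => (n : ℂ) ^ (s - 1)) hmono' s₀]
    refine Finset.sum_congr rfl fun n hn => ?_
    rw [polyDerivOp_natCast_cpow_sub_one _ _ (Finset.mem_Icc.1 hn).1 s₀, one_mul]
    congr 2
    rw [Polynomial.eval_comp, Polynomial.eval_sub, Polynomial.eval_one, Polynomial.eval_X]
    congr 1
    field_simp
  -- the norm of the `K`-error via reflection
  have h1s₀ : 1 - conj s₀ = (((1 - σ : ℝ)) : ℂ) + t * I := by
    simp only [hs₀, map_add, map_mul, Complex.conj_ofReal, Complex.conj_I]
    push_cast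
    ring
  have hσ' : |1 - σ| ≤ A + 1 := by
    rw [abs_le] at hσ ⊢; constructor <;> linarith [hσ.1, hσ.2]
  have hM₂ : ∀ w ∈ sphere (1 - conj s₀) L⁻¹, ‖E w‖ ≤
      17 * (8 : ℝ) ^ (A + 1) * x₀ ^ (L⁻¹) * x₀ ^ (-(1 - σ)) := by
    intro w hw
    rw [hEeq]
    rw [h1s₀] at hw
    exact norm_riemannAuxErr_le_of_mem_sphere (by linarith) hσ' hr0 hrhalf ht128 (by linarith) hw
  have h2 : ‖polyDerivOp (φ.comp (1 - X)) L⁻¹ E' s₀‖ ≤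
      (∑ k ∈ (φ.comp (1 - X)).support, |(φ.comp (1 - X)).coeff k| * (k.factorial : ℝ)) *
        (17 * (8 : ℝ) ^ (A + 1) * x₀ ^ (L⁻¹) * x₀ ^ (-(1 - σ))) := by
    have hrefl := conj_polyDerivOp_one_sub_conj (φ.comp (1 - X)) (-L⁻¹) hEd s₀
    rw [neg_neg] at hrefl
    simp only [hE'] at hrefl ⊢
    rw [← hrefl, Complex.norm_conj]
    have h := norm_polyDerivOp_le (φ.comp (1 - X)) (-L⁻¹) hEd hr0 hM₂
    rwa [sum_coeff_transfer_eq _ hL0 (by rw [abs_neg, abs_of_pos hr0])] at h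
  -- (3) assemble
  have hV : conreyV φ L s₀ -
      ((∑ n ∈ Finset.Icc 1 N, ((φ.eval (Real.log n / L) : ℝ) : ℂ) * (n : ℂ) ^ (-s₀)) +
        rsChi s₀ * ∑ n ∈ Finset.Icc 1 N, ((φ.eval (1 - Real.log n / L) : ℝ) : ℂ) * (n : ℂ) ^ (s₀ - 1)) =
      polyDerivOp φ (-L⁻¹) E s₀ + rsChi s₀ * polyDerivOp (φ.comp (1 - X)) L⁻¹ E' s₀ := by
    rw [conreyV, hR, hE'op, hS'op]
    ring
  rw [hV]
  -- numerical constants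
  set Cφ := ∑ k ∈ φ.support, |φ.coeff k| * (k.factorial : ℝ) with hCφ
  set Cq := ∑ k ∈ (φ.comp (1 - X)).support, |(φ.comp (1 - X)).coeff k| * (k.factorial : ℝ) with hCq
  have hCφ0 : 0 ≤ Cφ := Finset.sum_nonneg fun k _ => by positivity
  have hCq0 : 0 ≤ Cq := Finset.sum_nonneg fun k _ => by positivity
  have h8A : (8 : ℝ) ^ A ≤ (8 : ℝ) ^ (A + 1) := Real.rpow_le_rpow_of_exponent_le (by norm_num) (by linarith)
  have h8pos : 0 ≤ (8 : ℝ) ^ (A + 1) := Real.rpow_nonneg (by norm_num) _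
  have hxσ : 0 ≤ x₀ ^ (-σ) := Real.rpow_nonneg hx₀pos.le _
  have hxσ' : x₀ ^ (-(1 - σ)) = x₀ ^ (σ - 1) := by congr 1; ring
  rw [hxσ'] at h2
  have hxσ1 : 0 ≤ x₀ ^ (σ - 1) := Real.rpow_nonneg hx₀pos.le _
  calc ‖polyDerivOp φ (-L⁻¹) E s₀ + rsChi s₀ * polyDerivOp (φ.comp (1 - X)) L⁻¹ E' s₀‖
      ≤ ‖polyDerivOp φ (-L⁻¹) E s₀‖ + ‖rsChi s₀‖ * ‖polyDerivOp (φ.comp (1 - X)) L⁻¹ E' s₀‖ := by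
        refine (norm_add_le _ _).trans ?_
        rw [norm_mul]
    _ ≤ Cφ * (17 * (8 : ℝ) ^ A * x₀ ^ (L⁻¹) * x₀ ^ (-σ)) +
        ‖rsChi s₀‖ * (Cq * (17 * (8 : ℝ) ^ (A + 1) * x₀ ^ (L⁻¹) * x₀ ^ (σ - 1))) := by
        gcongr
    _ ≤ Cφ * (17 * (8 : ℝ) ^ (A + 1) * Real.exp 1 * x₀ ^ (-σ)) +
        ‖rsChi s₀‖ * (Cq * (17 * (8 : ℝ) ^ (A + 1) * Real.exp 1 * x₀ ^ (σ - 1))) := by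
        gcongr
    _ = 17 * Real.exp 1 * (8 : ℝ) ^ (A + 1) * (Cφ * x₀ ^ (-σ) + Cq * ‖rsChi s₀‖ * x₀ ^ (σ - 1)) := by
        ring

/-- **Conrey's Lemma 4, `O(x₀^{−σ})` form.** Under the hypotheses of `norm_conreyV_sub_afe_le` and
`t ≥ 38(A+1)²`, Stirling's formula for `χ`
(`Literature.NumberTheory.LFunctions.abs_norm_rsChi_sub_rpow_le`: `‖χ(σ+it)‖ ≤ 2 (t/2π)^{½−σ}`)
turns the second error into `x₀^{1−2σ} x₀^{σ−1} = x₀^{−σ}`: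
`‖V(σ+it) − (Σ 𝜙(log n/L) n^{−s} + χ(s) Σ 𝜙(1 − log n/L) n^{s−1})‖ ≤ 17e·8^{A+1} (C_𝜙 + 2C_q) x₀^{−σ}`
(Conrey: "`V = C + χD + O(T^{−1/4})`" at `σ ≈ ½`; Levinson (2.18): `H₁(t) = O(t^{−1/4})`).
[cite: Conrey1983, §4 Lemma 4] -/
theorem norm_conreyV_sub_afe_le_rpow (φ : ℝ[X]) {A T t σ : ℝ} (hA : 1 ≤ A) (hσ : |σ| ≤ A)
    (hT2 : Real.exp 2 ≤ T) (hT128 : 128 * π + 1 ≤ T) (hTx : 4 * A + 8 ≤ Real.sqrt (T / (2 * π)))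
    (hT38 : 38 * (A + 1) ^ 2 ≤ T) (hTt : T ≤ t) (ht2T : t ≤ 2 * T) :
    ‖conreyV φ (Real.log T) (σ + t * I) -
        (∑ n ∈ Finset.Icc 1 ⌊Real.sqrt (t / (2 * π))⌋₊,
            ((φ.eval (Real.log n / Real.log T) : ℝ) : ℂ) * (n : ℂ) ^ (-((σ : ℂ) + t * I)) +
          rsChi (σ + t * I) * ∑ n ∈ Finset.Icc 1 ⌊Real.sqrt (t / (2 * π))⌋₊,
            ((φ.eval (1 - Real.log n / Real.log T) : ℝ) : ℂ) * (n : ℂ) ^ (((σ : ℂ) + t * I) - 1))‖ ≤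
      17 * Real.exp 1 * (8 : ℝ) ^ (A + 1) *
        ((∑ k ∈ φ.support, |φ.coeff k| * (k.factorial : ℝ)) +
          2 * (∑ k ∈ (φ.comp (1 - X)).support, |(φ.comp (1 - X)).coeff k| * (k.factorial : ℝ))) *
        Real.sqrt (t / (2 * π)) ^ (-σ) := by
  have hπ := Real.pi_pos
  have ht0 : 0 < t := by nlinarith
  have h := norm_conreyV_sub_afe_le φ hA hσ hT2 hT128 hTx hTt ht2T
  refine h.trans ?_
  set x₀ := Real.sqrt (t / (2 * π)) with hx₀def
  have hx₀pos : 0 < x₀ := Real.sqrt_pos.2 (by positivity)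
  have hx₀sq : x₀ ^ (2 : ℝ) = t / (2 * π) := by
    rw [hx₀def, Real.rpow_two, Real.sq_sqrt (by positivity)]
  -- `‖χ(σ+it)‖ ≤ 2 (t/2π)^{½−σ} = 2 x₀^{1−2σ}`
  have hχ := abs_norm_rsChi_sub_rpow_le hA hσ (hT38.trans hTt)
  have hrpow : (t / (2 * π)) ^ (1 / 2 - σ) = x₀ ^ (1 - 2 * σ) := by
    rw [← hx₀sq, ← Real.rpow_mul hx₀pos.le]; congr 1; ring
  have hfrac : 38 * (A + 1) ^ 2 / t ≤ 1 := by
    rw [div_le_one ht0]; exact hT38.trans hTt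
  have hχ2 : ‖rsChi (σ + t * I)‖ ≤ 2 * x₀ ^ (1 - 2 * σ) := by
    have h1 := (abs_le.1 hχ).2
    rw [hrpow] at h1
    have hp : 0 ≤ x₀ ^ (1 - 2 * σ) := Real.rpow_nonneg hx₀pos.le _
    have : 38 * (A + 1) ^ 2 / t * x₀ ^ (1 - 2 * σ) ≤ 1 * x₀ ^ (1 - 2 * σ) :=
      mul_le_mul_of_nonneg_right hfrac hp
    linarith
  have hxx : x₀ ^ (1 - 2 * σ) * x₀ ^ (σ - 1) = x₀ ^ (-σ) := by
    rw [← Real.rpow_add hx₀pos]; congr 1; ring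
  set Cφ := ∑ k ∈ φ.support, |φ.coeff k| * (k.factorial : ℝ) with hCφ
  set Cq := ∑ k ∈ (φ.comp (1 - X)).support, |(φ.comp (1 - X)).coeff k| * (k.factorial : ℝ) with hCq
  have hCq0 : 0 ≤ Cq := Finset.sum_nonneg fun k _ => by positivity
  have hxσ1 : 0 ≤ x₀ ^ (σ - 1) := Real.rpow_nonneg hx₀pos.le _
  have hkey : Cq * ‖rsChi (σ + t * I)‖ * x₀ ^ (σ - 1) ≤ 2 * Cq * x₀ ^ (-σ) := by
    calc Cq * ‖rsChi (σ + t * I)‖ * x₀ ^ (σ - 1) ≤ Cq * (2 * x₀ ^ (1 - 2 * σ)) * x₀ ^ (σ - 1) := by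
          gcongr
      _ = 2 * Cq * (x₀ ^ (1 - 2 * σ) * x₀ ^ (σ - 1)) := by ring
      _ = 2 * Cq * x₀ ^ (-σ) := by rw [hxx]
  have hpre : 0 ≤ 17 * Real.exp 1 * (8 : ℝ) ^ (A + 1) := by positivity
  calc 17 * Real.exp 1 * (8 : ℝ) ^ (A + 1) * (Cφ * x₀ ^ (-σ) + Cq * ‖rsChi (σ + t * I)‖ * x₀ ^ (σ - 1))
      ≤ 17 * Real.exp 1 * (8 : ℝ) ^ (A + 1) * (Cφ * x₀ ^ (-σ) + 2 * Cq * x₀ ^ (-σ)) := by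
        gcongr
    _ = 17 * Real.exp 1 * (8 : ℝ) ^ (A + 1) * (Cφ + 2 * Cq) * x₀ ^ (-σ) := by ring

end ConreyAFE

end Literature.NumberTheory.LFunctions
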